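import Literature.MathematicalPhysics.QuantumFieldTheory.Balaban1983to89.B9Eq326LocalPartTowerSupDecay
import Literature.MathematicalPhysics.QuantumFieldTheory.Balaban1983to89.B9Eq326LocalPartBlockDecayTowerDiagonalClosed
import Literature.MathematicalPhysics.QuantumFieldTheory.Balaban1983to89.B9Eq326WeitzenbockHolonomyLetter
import Literature.MathematicalPhysics.QuantumFieldTheory.Balaban1983to89.B9Eq347LocalFromBlockDecay
import Literature.MathematicalPhysics.QuantumFieldTheory.Balaban1983to89.B3Op116ScaleChains

/-!
# `Balaban1983to89.B9Eq326LocalPartTowerSupDecayDiagonalClosed` — T. Bałaban, *Propagators for lattice gauge theories in a background field*, Commun. Math.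
# Phys. **99** (1985) 389–434 [Balaban1985BackgroundPropagators] Thm 3.3 (3.47) p. 398 *«|G(U; b, b′)| ≤ B₀e^{−δ₀d(b,b′)}η^{2−d} …»* with (3.49) p. 399 («the
# constants … independent of the field configuration»), (3.26) p. 395 (the local part), (3.35)–(3.37) p. 396: **THE DECAYED SUP ROW OF THE TOWER LOCAL PART,
# FULLY CLOSED ON PRINT's DIAGONAL — `∃ α₁ B δ` BEFORE `∀ n η c₀ c₁ m U`: for a source `f` supported over ONE unit block `v` with `‖f(b)‖ ≤ F`,
# `‖(A₀,k⁻¹f)(b₀)‖ ≤ B·e^{−δ·d_m(Π(b₀), v)}·F` at EVERY bond, every height `n`, every background of the MODEL letters in ONE window `α ≤ α₁` (and the loop window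
# `Σ_{j<n+1}α_j ≤ A_Q`)** — beta-an4 g109's INTERFACE REQUEST D4 shape `exists_local_letter_…` FOR THE LOCAL PART `A₀,k = Δ(U) + D_UD*_U + Q_k(U)†(a•Q_k(U))`
# (NOT yet for `G₁,k`: the Woodbury remainder needs storey J at the tower): ne9-leaf-03 g78's (EA0S) `B9Eq326LocalPartTowerSupDecay.norm_localInvK_apply_le_decay`
# with EVERY displayed letter inhabited — (D-E)₀,k by (FCL0), (T) by unitarity, `δ := αη²`, `δ_𝒦 := 4M_φM_φ′αη²` (K59), the fine rate `a⋆` of the OWNER's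
# `rate_explicit` (`λ ≥ 1∕2`, `a⋆L^{n+1} ∈ [1∕√(4d+1), 1]`), `k := d`, `a′ := min(r₁, κ₀∕3)`, `μ := d·c₁`, and `θ ≤ 1∕2` by the window

statement-level skeleton of published theorems with citation tags; proofs where landed; nothing here is a claim about the Yang–Mills mass gap

CITATION HEADER (lean-in-tree rule).  Audit cell `pub-balaban`, sub-cell `t4`, BINDER row NE9 (road ΔA-CT, leaf prover 03 `b2b-balaban-t4-ne9-formalise-leaf-03`
gen 78).  Imports BY NAME this lineage's (EA0S), (FCL0), (K) `B9Eq347LocalFromBlockDecay` (`norm_le_sqrt_mass_mul`), ne9-leaf-05's (K59)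
`B9Eq326WeitzenbockHolonomyLetter`, the cell's `B3Op116ScaleChains` (`latticeConst_antitone`); through (EA0S) the OWNER's `rate_explicit` and
`norm_adTransportW_eq`.  Sources READ first-hand: [Balaban1985BackgroundPropagators] (`paper:balaban1985-cmp99-background-propagators`) pp. 393–399.  Print's
sup rows are proved by the random walk of Sect. C; NOTHING of it is reproduced; [folklore] composition BY NAME + real arithmetic.

WHAT IS PROVED (sorry-free; proof lane — no `def`; [folklore]).
* §1 `sum_bondMass_bigBlock_le` (the bond-block mass at the tower: `Σ_{b : Π(b₋) = v} c₀ ≤ d·c₁` on the diagonal), `rate_letters` (the OWNER's `a⋆`: `0 < a⋆ ≤ 1`,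
  `1∕2 ≤ λ`, `κ₀ := √(1∕(4d+1)) ≤ a⋆L^{n+1} ≤ 1`), `geom_sum_inv_le` (`Σ_{l<d}λ^{−l} ≤ 2^d` for `λ ≥ 1∕2`), and five PRIVATE real-arithmetic
  letters `geom_sum_inv_le`, `assemble_le`, `theta_le`, `p2_bound`, `closing_le` (the geometric sum, the constant, the window, the penalty letter, `A∕(1−θ) ≤ 2A_b`).
* §2 **`exists_sup_decay_localInvK_diagonal_closed`** — the display above.
HONEST SCOPE.  Composition + thresholds; crude constants; the LOCAL PART only; NOT print's `B₀`∕`δ₀`; NOT NE9 (cell pub-balaban: NE9 NOT PRINTED ∕ NOT PROVED;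
«NE9 ⇐ the named binders»; row WALLED ON A MODEL (O-NE9-1; #5 UNRULED); spine PROVED 0∕9; rung (B)+1 on a finite T⁴ — NOT infinite volume, NOT mass gap, NOT
BetaPertH, NOT Clay; HONEST DEPENDENCY: continuum YM on T⁴ ⇐ BetaPertH ∧ nine spine estimates (0/9 proved); BetaPertH ⇐ (D1) ∧ (D4) ∧ CAP+tail; G-an2-4 gates asym,
D1 and NE2/3/4).  NEW file; nothing modified.  Net new unproved facts: 0.
-/

noncomputable section

open scoped InnerProductSpace ComplexConjugate BigOperators
open NormedSpace

namespace Literature.MathematicalPhysics.QuantumFieldTheory.Balaban1983to89.B9Eq326LocalPartTowerSupDecayDiagonalClosed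

open B4Sect5Torus (TSite tdist tdist_nonneg)
open B4Sect5Proof (latticeConst latticeConst_nonneg)
open B9SectCLatticeCarrier (Bond DirPair bpos shift unshift)
open B9Eq311L2Pairing (WL2)
open B9Eq319QprimeTorus (fineP blockCoord)
open B7Prop1Explicit (U1 Wcx boxVec)
open B11Eq103H1Complex (BondL2K greenK covDerivL2K covDivL2K)
open B9Eq310DeltaPrime (plaqHolU reHol imHol)
open B9Eq310HessianOperator (adTransportW hessOp)
open B9Eq315QTorus (perCfg cornerSite)
open B9Eq315QTower (towerP towerP_apply UlevOf)
open B9Eq316TowerFlatIsOneStep (towerP_eq_fineP_pow siteCast)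
open B9Eq326OperatorTower (QkW laplaceAk)
open B9Eq342TowerBigBlocks (card_sites_bigBlock_le)
open B9Eq342GreenPrimeSupBound (norm_adTransportW_eq norm_adTransportW_inv_eq)
open B9Eq342GreenPrimeSupBoundDecayCosh (rate_explicit)
open B9Eq326WeitzenbockHolonomyLetter (holonomy_letter)
open B9Eq347LocalFromBlockDecay (norm_le_sqrt_mass_mul)
open B3Op116ScaleChains (latticeConst_antitone)
open B9Eq326LocalPartTowerSupDecay (norm_localInvK_apply_le_decay)
open B9Eq326LocalPartBlockDecayTowerDiagonalClosed (exists_block_decay_localInvK_diagonal_closed)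
open B9Eq3126H1RowLettersDiagonalClosed (exists_H1_row_letters_diagonal_closed)

/-! ## §1 Small letters: the bond-block mass, the rate, the geometric sum, the real arithmetic -/

section Letters

variable {d : ℕ} (L : ℕ) [NeZero L] (m : Fin d → ℕ) [∀ i, NeZero (m i)] (n : ℕ)

omit [∀ i, NeZero (m i)] in
/-- **THE BOND-BLOCK MASS AT THE TOWER**: `Σ_{b : Π(b₋) = v} c₀ ≤ c₀·d·(L^{n+1})^d` (`d` directions × the fibre count of one big block). [folklore]
[cite: Balaban1985BackgroundPropagators, (3.11) p.392, (3.49) p.399; Balaban1985Averaging, (2) p.17] -/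
theorem sum_bondMass_bigBlock_le {c₀ : ℝ} (hc₀ : 0 ≤ c₀) (v : TSite d m) :
    ∑ b : Bond d (towerP L m (n + 1)),
        (if blockCoord (L ^ (n + 1)) m (siteCast (towerP_eq_fineP_pow L m (n + 1)) b.1) = v then c₀ else 0) ≤
      c₀ * (d * ((L : ℝ) ^ (n + 1)) ^ d) := by
  classical
  have hcard := card_sites_bigBlock_le L m (n + 1) v
  have hinner : ∀ x : TSite d (towerP L m (n + 1)),
      ∑ _μ : Fin d, (if blockCoord (L ^ (n + 1)) m (siteCast (towerP_eq_fineP_pow L m (n + 1)) x) = v then c₀ else 0) =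
        (d : ℝ) * (if blockCoord (L ^ (n + 1)) m (siteCast (towerP_eq_fineP_pow L m (n + 1)) x) = v then c₀ else 0) := fun x => by
    rw [Finset.sum_const, Finset.card_univ, Fintype.card_fin, nsmul_eq_mul]
  calc ∑ b : Bond d (towerP L m (n + 1)),
        (if blockCoord (L ^ (n + 1)) m (siteCast (towerP_eq_fineP_pow L m (n + 1)) b.1) = v then c₀ else 0)
      = ∑ x : TSite d (towerP L m (n + 1)), ∑ _μ : Fin d,
          (if blockCoord (L ^ (n + 1)) m (siteCast (towerP_eq_fineP_pow L m (n + 1)) x) = v then c₀ else 0) := by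
        rw [Fintype.sum_prod_type]
    _ = (d : ℝ) * ∑ x : TSite d (towerP L m (n + 1)),
          (if blockCoord (L ^ (n + 1)) m (siteCast (towerP_eq_fineP_pow L m (n + 1)) x) = v then c₀ else 0) := by
        rw [Finset.mul_sum]; exact Finset.sum_congr rfl fun x _ => hinner x
    _ = (d : ℝ) * (c₀ * ((Finset.univ.filter fun x : TSite d (towerP L m (n + 1)) =>
          blockCoord (L ^ (n + 1)) m (siteCast (towerP_eq_fineP_pow L m (n + 1)) x) = v).card : ℝ)) := by
        rw [← Finset.sum_filter, Finset.sum_const, nsmul_eq_mul, mul_comm (_ : ℝ) c₀]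
    _ ≤ (d : ℝ) * (c₀ * ((L ^ (n + 1)) ^ d : ℕ)) := by
        gcongr
    _ = c₀ * (d * ((L : ℝ) ^ (n + 1)) ^ d) := by push_cast; ring

omit [NeZero L] [∀ i, NeZero (m i)] in
/-- **THE RATE LETTERS** (the OWNER's `rate_explicit` at `m = 1`, `t = L^{n+1}`): `a⋆ = √(1∕(4d(L^{n+1})² + 1))` has `0 < a⋆ ≤ 1`, `1∕2 ≤ λ(a⋆)`,
`√(1∕(4d+1)) ≤ a⋆L^{n+1} ≤ 1`. [folklore] [cite: Balaban1985BackgroundPropagators, Thm 3.1 (3.42) p.397; Balaban1984PropagatorsI, p.36] -/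
theorem rate_letters (hd : 1 ≤ d) (hL : 1 ≤ L) :
    0 < Real.sqrt (1 / (4 * d * ((L : ℝ) ^ (n + 1)) ^ 2 + 1)) ∧ Real.sqrt (1 / (4 * d * ((L : ℝ) ^ (n + 1)) ^ 2 + 1)) ≤ 1 ∧
      1 / 2 ≤ 1 - 2 * d * ((L : ℝ) ^ (n + 1)) ^ 2 * (Real.cosh (Real.sqrt (1 / (4 * d * ((L : ℝ) ^ (n + 1)) ^ 2 + 1))) - 1) ∧
      Real.sqrt (1 / (4 * d + 1)) ≤ Real.sqrt (1 / (4 * d * ((L : ℝ) ^ (n + 1)) ^ 2 + 1)) * (L : ℝ) ^ (n + 1) ∧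
      Real.sqrt (1 / (4 * d * ((L : ℝ) ^ (n + 1)) ^ 2 + 1)) * (L : ℝ) ^ (n + 1) ≤ 1 := by
  have hL1 : (1 : ℝ) ≤ (L : ℝ) ^ (n + 1) := one_le_pow₀ (by exact_mod_cast hL)
  obtain ⟨h1, h2, h3, h4⟩ := rate_explicit (d := d) ((L : ℝ) ^ (n + 1)) 1 one_pos hL1
  refine ⟨h1, h2, h3, h4, ?_⟩
  -- `a⋆·t ≤ 1`: `a⋆² t² = t²∕(4dt² + 1) ≤ 1`
  have hD : 0 < 4 * (d : ℝ) * ((L : ℝ) ^ (n + 1)) ^ 2 + 1 := by positivity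
  have hsq : Real.sqrt (1 / (4 * d * ((L : ℝ) ^ (n + 1)) ^ 2 + 1)) ^ 2 = 1 / (4 * d * ((L : ℝ) ^ (n + 1)) ^ 2 + 1) :=
    Real.sq_sqrt (by positivity)
  have hprod : (Real.sqrt (1 / (4 * d * ((L : ℝ) ^ (n + 1)) ^ 2 + 1)) * (L : ℝ) ^ (n + 1)) ^ 2 ≤ 1 := by
    rw [mul_pow, hsq, div_mul_eq_mul_div, one_mul, div_le_one hD]
    have hd1 : (1 : ℝ) ≤ d := by exact_mod_cast hd
    nlinarith [mul_nonneg (sq_nonneg ((L : ℝ) ^ (n + 1))) (by linarith : (0 : ℝ) ≤ 4 * d - 1)]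
  have h0 : 0 ≤ Real.sqrt (1 / (4 * d * ((L : ℝ) ^ (n + 1)) ^ 2 + 1)) * (L : ℝ) ^ (n + 1) := mul_nonneg h1.le (zero_le_one.trans hL1)
  have h5 := Real.sqrt_le_sqrt hprod
  rwa [Real.sqrt_sq h0, Real.sqrt_one] at h5

/-- **THE GEOMETRIC SUM**: `1∕2 ≤ λ` ⟹ `Σ_{l<k}(1∕λ)^l ≤ 2^k`. [folklore] -/
private theorem geom_sum_inv_le {lam : ℝ} (hlam : 1 / 2 ≤ lam) (k : ℕ) : ∑ l ∈ Finset.range k, (1 / lam) ^ l ≤ (2 : ℝ) ^ k := by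
  have hl0 : 0 < lam := by linarith
  have h2 : 1 / lam ≤ 2 := by rw [div_le_iff₀ hl0]; linarith
  calc ∑ l ∈ Finset.range k, (1 / lam) ^ l ≤ ∑ l ∈ Finset.range k, (2 : ℝ) ^ l :=
        Finset.sum_le_sum fun l _ => pow_le_pow_left₀ (by positivity) h2 l
    _ ≤ (2 : ℝ) ^ k := by
        induction k with
        | zero => simp
        | succ k ih => rw [Finset.sum_range_succ, pow_succ]; linarith [pow_nonneg (by norm_num : (0:ℝ) ≤ 2) k]

/-- **THE ASSEMBLY INEQUALITY** for (EA0S)'s constant: with `M ≤ 2e`, `1∕2 ≤ λ`, `Σ ≤ S_g`, `p₂·√μ ≤ P₂`, `C₃·√μ ≤ C_{3S}`, `√(MS) ≤ M_{Sb}` (all nonneg),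
`M(1 + p₂KC_E√μ)∕λ·Σ + 1^k·C₃·C_E·√(MS)·√μ ≤ 2e·(1 + P₂KC_E)·2·S_g + C_{3S}·C_E·M_{Sb}`. [folklore] -/
private theorem assemble_le {M lam Sg Sm p₂ K CE sμ C3 sMS P2 C3S MSb : ℝ} (hM : M ≤ 2 * Real.exp 1) (hlam : 1 / 2 ≤ lam)
    (hSm0 : 0 ≤ Sm) (hSm : Sm ≤ Sg) (hp₂ : 0 ≤ p₂) (hK : 0 ≤ K) (hCE : 0 ≤ CE) (hsμ : 0 ≤ sμ) (hC3 : 0 ≤ C3) (hsMS : 0 ≤ sMS)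
    (hP2 : p₂ * sμ ≤ P2) (hC3S : C3 * sμ ≤ C3S) (hMSb : sMS ≤ MSb) (k : ℕ) :
    M * (1 + p₂ * K * CE * sμ) / lam * Sm + 1 ^ k * C3 * CE * sMS * sμ ≤ 2 * Real.exp 1 * (1 + P2 * K * CE) * 2 * Sg + C3S * CE * MSb := by
  have hl0 : 0 < lam := by linarith
  have hinv : 1 / lam ≤ 2 := by rw [div_le_iff₀ hl0]; linarith
  have hX : 1 + p₂ * K * CE * sμ ≤ 1 + P2 * K * CE := by nlinarith [mul_nonneg hK hCE, mul_le_mul_of_nonneg_right hP2 (mul_nonneg hK hCE)]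
  have hX0 : 0 ≤ 1 + p₂ * K * CE * sμ := by positivity
  have hP20 : 0 ≤ P2 := (mul_nonneg hp₂ hsμ).trans hP2
  have h1 : M * (1 + p₂ * K * CE * sμ) / lam * Sm ≤ 2 * Real.exp 1 * (1 + P2 * K * CE) * 2 * Sg := by
    rw [div_eq_mul_one_div]
    calc M * (1 + p₂ * K * CE * sμ) * (1 / lam) * Sm ≤ (2 * Real.exp 1) * (1 + P2 * K * CE) * 2 * Sg := by gcongr
      _ = 2 * Real.exp 1 * (1 + P2 * K * CE) * 2 * Sg := by ring
  have h2 : 1 ^ k * C3 * CE * sMS * sμ ≤ C3S * CE * MSb := by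
    rw [one_pow, one_mul]
    have hC3S0 : 0 ≤ C3S := (mul_nonneg hC3 hsμ).trans hC3S
    calc C3 * CE * sMS * sμ = (C3 * sμ) * CE * sMS := by ring
      _ ≤ C3S * CE * MSb := by gcongr
  linarith

/-- **THE WINDOW INEQUALITY** for (EA0S)'s `θ`: `M·(p_∞·E)∕λ·Σ ≤ 2e·P·E·2·S_g` from `M ≤ 2e`, `1∕2 ≤ λ`, `Σ ≤ S_g`, `p_∞ ≤ P`. [folklore] -/
private theorem theta_le {M pinf E lam Sm Sg P : ℝ} (hM : M ≤ 2 * Real.exp 1) (hlam : 1 / 2 ≤ lam) (hSm0 : 0 ≤ Sm) (hSm : Sm ≤ Sg) (hp0 : 0 ≤ pinf)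
    (hp : pinf ≤ P) (hE : 0 ≤ E) : M * (pinf * E) / lam * Sm ≤ 2 * Real.exp 1 * P * E * 2 * Sg := by
  have hl0 : 0 < lam := by linarith
  have hinv : 1 / lam ≤ 2 := by rw [div_le_iff₀ hl0]; linarith
  have hP0 : 0 ≤ P := hp0.trans hp
  rw [div_eq_mul_one_div]
  calc M * (pinf * E) * (1 / lam) * Sm ≤ (2 * Real.exp 1) * (P * E) * 2 * Sg := by gcongr
    _ = 2 * Real.exp 1 * P * E * 2 * Sg := by ring

/-- **THE PENALTY-LETTER INEQUALITY**: `A·(G·(C∕s_c·2))·(s_d·s_c) ≤ A·(G·(C₁·2))·s_d` for `C ≤ C₁`, `s_c ≠ 0`. [folklore] -/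
private theorem p2_bound {A G C C₁ sc sd : ℝ} (hA : 0 ≤ A) (hG : 0 ≤ G) (hsc : sc ≠ 0) (hsd : 0 ≤ sd) (hC : C ≤ C₁) :
    A * (G * (C / sc * 2)) * (sd * sc) ≤ A * (G * (C₁ * 2)) * sd := by
  rw [show A * (G * (C / sc * 2)) * (sd * sc) = A * (G * (C * 2)) * sd * (sc / sc) by ring, div_self hsc, mul_one]
  gcongr

/-- **THE CLOSING INEQUALITY**: `A ≤ A_b`, `θ ≤ 1∕2`, `0 ≤ A_b` ⟹ `A∕(1 − θ) ≤ 2A_b`. [folklore] -/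
private theorem closing_le {A θ Ab : ℝ} (hA : A ≤ Ab) (hθ : θ ≤ 1 / 2) (hAb : 0 ≤ Ab) : A / (1 - θ) ≤ 2 * Ab := by
  rw [div_le_iff₀ (by linarith)]
  nlinarith [mul_nonneg hAb (by linarith : (0 : ℝ) ≤ 1 - 2 * θ)]

end Letters

/-! ## §2 The decayed sup row of the tower local part, fully closed -/

section Closed

variable {d : ℕ} (hd : 1 ≤ d) (L : ℕ) [NeZero L] (hL : 1 ≤ L) (hL3 : 3 ≤ L)
  {𝔸 : Type*} [NormedRing 𝔸] [NormedAlgebra ℂ 𝔸] [CompleteSpace 𝔸] [NormOneClass 𝔸] [StarRing 𝔸] [NormedStarGroup 𝔸] [StarModule ℂ 𝔸]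
  {W : Type*} [NormedAddCommGroup W] [InnerProductSpace ℂ W] [FiniteDimensional ℂ W] (φ : W ≃ₗ[ℂ] 𝔸)
  {Mφ Mφ' : ℝ} (hMφ : 0 ≤ Mφ) (hMφ' : 0 ≤ Mφ') (hφ : ∀ w, ‖φ w‖ ≤ Mφ * ‖w‖) (hφ' : ∀ X, ‖φ.symm X‖ ≤ Mφ' * ‖X‖) (hstar : ∀ X : 𝔸, ‖star X‖ ≤ ‖X‖)
  {a : ℝ} (ha : 0 < a) {a' : ℝ} (ha' : 0 < a') {ϱ : ℝ} (hϱ0 : 0 ≤ ϱ) (hϱ1 : ϱ < 1)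
  (τ : 𝔸 →ₗ[ℂ] ℂ) {Cτ : ℝ} (hτ : ∀ X, ‖τ X‖ ≤ Cτ * ‖X‖) (hCτ : 0 ≤ Cτ) {Mτ : ℝ} (hτm : ∀ X Y : 𝔸, ‖τ (X * Y)‖ ≤ Mτ * ‖X‖ * ‖Y‖) (hMτ : 0 ≤ Mτ)
  {ρw : ℝ} (hρw : 0 ≤ ρw)
  (hτ₁ : ∀ X : 𝔸, τ (star X) = conj (τ X)) (hτ₂ : ∀ X Y : 𝔸, τ (X * Y) = τ (Y * X)) (hφτ : ∀ X Y : 𝔸, ⟪φ.symm X, φ.symm Y⟫_ℂ = τ (star X * Y))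
  (AQ : ℝ)

set_option maxHeartbeats 400000 in -- ≈ 45 binders + nine `set` constants: the final defeq assembly exceeds the default budget
include hd hL hL3 hMφ hMφ' hφ hφ' hstar ha ha' hϱ0 hϱ1 hτ hCτ hτm hMτ hρw hτ₁ hτ₂ hφτ in
/-- **THE DECAYED SUP ROW OF THE TOWER LOCAL PART, FULLY CLOSED ON THE DIAGONAL — `∃ α₁ B δ` BEFORE `∀ n η c₀ c₁ m U`.**  For every height `n`, spacing `η`
(`ηL^{n+1} = 1`), weights on the diagonal with `|η|^d∕c₀ ≤ ρ_w`, lattice `m` (`1 ≤ m_i`), background `U` of the MODEL letters in the window `α ≤ α₁` (and the loop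
window `Σ_{j<n+1}α_j ≤ A_Q`), every positivity witness `hpos₀` of `A₀ = Δ(U) + D_UD*_U + Q_k(U)†(a•Q_k(U))`, every big-block bond family `P`, every source `f`
supported over the unit block `v` with `‖f(b)‖ ≤ F`: `‖(A₀⁻¹f)(b₀)‖ ≤ B·e^{−δ·d_m(Π(b₀), v)}·F` — (EA0S) with every letter inhabited. [cite: Balaban1985BackgroundPropagators,
Thm 3.3 (3.47) p.398, (3.49) p.399, (3.26) p.395, (3.35)–(3.37) p.396; Balaban1985Variational, (134)–(136) p.298; Balaban1984PropagatorsI, p.36] -/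
theorem exists_sup_decay_localInvK_diagonal_closed :
    ∃ α₁ B δ : ℝ, 0 < α₁ ∧ 0 ≤ B ∧ 0 < δ ∧
      ∀ (n : ℕ) (η : ℝ) (_hηL : η * (L : ℝ) ^ (n + 1) = 1) (c₀ c₁ : ℝ) [Fact (0 < c₀)] [Fact (0 < c₁)]
        (_hw : c₀ * ((L : ℝ) ^ (n + 1)) ^ d = c₁) (_hρ : |η| ^ d / c₀ ≤ ρw) (m : Fin d → ℕ) [∀ i, NeZero (m i)] (_hm : ∀ i, 1 ≤ m i)
        (U : Bond d (towerP L m (n + 1)) → 𝔸ˣ) (αU : ℕ → ℝ) (_hα0 : ∀ j, 0 ≤ αU j) (hα1 : ∀ j, αU j ≤ 1 / 64)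
        (hU1 : ∀ (j : ℕ) (x : B7Prop1Explicit.Site d) (k : Fin d), perCfg (towerP L m (j + 1)) (UlevOf L m (n + 1) U j) x k ∈ U1 𝔸)
        (hreg : ∀ (j : ℕ) (y : TSite d (towerP L m j)) (k : Fin d) (ρ' : Fin d → Fin L),
          ‖((Wcx L (perCfg (towerP L m (j + 1)) (UlevOf L m (n + 1) U j)) (cornerSite L y) k (boxVec L ρ') : 𝔸ˣ) : 𝔸) - 1‖ ≤ αU j)
        (εU : ℕ → ℝ) (_hεU : ∀ j, 0 ≤ εU j) (_hUε : ∀ (j : ℕ) (b : Bond d (towerP L m (j + 1))), ‖(UlevOf L m (n + 1) U j b : 𝔸) - 1‖ ≤ εU j)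
        (_hLb : ∀ (j : ℕ) (b : Bond d (towerP L m (j + 1))), UlevOf L m (n + 1) U j b ∈ U1 𝔸)
        (α : ℝ) (_hα : 0 ≤ α) (_hαle : α ≤ α₁)
        (_hUst : ∀ b, star (U b : 𝔸) = (((U b)⁻¹ : 𝔸ˣ) : 𝔸)) (_hUb : ∀ b, U b ∈ U1 𝔸) (_hUη : ∀ b, ‖(U b : 𝔸) - 1‖ ≤ α * η)
        (_hpl : ∀ p : B9SectCLatticeCarrier.Plaq d (towerP L m (n + 1)), ‖(plaqHolU U p : 𝔸) - 1‖ ≤ α * η ^ 2)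
        (_hεg : ∀ j < n + 1, εU j ≤ α * ϱ ^ j) (_hAQ : ∑ j ∈ Finset.range (n + 1), αU j ≤ AQ)
        (A₀ : BondL2K ℂ d (towerP L m (n + 1)) c₀ W →ₗ[ℂ] BondL2K ℂ d (towerP L m (n + 1)) c₀ W)
        (_hA₀ : A₀ = hessOp φ η U τ + covDerivL2K ℂ c₀ ((η : ℂ))⁻¹ (adTransportW φ U) ∘ₗ covDivL2K ℂ c₀ ((η : ℂ))⁻¹ (adTransportW φ fun b => (U b)⁻¹) +
          LinearMap.adjoint (QkW L m n φ U hL αU hα1 hU1 hreg (c₀ := c₀) (c₁ := c₁)) ∘ₗ ((a : ℂ) • QkW L m n φ U hL αU hα1 hU1 hreg (c₀ := c₀) (c₁ := c₁)))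
        (hpos₀ : ∀ x : BondL2K ℂ d (towerP L m (n + 1)) c₀ W, x ≠ 0 → 0 < RCLike.re ⟪x, A₀ x⟫_ℂ)
        (PB : TSite d m → BondL2K ℂ d (towerP L m (n + 1)) c₀ W →L[ℂ] BondL2K ℂ d (towerP L m (n + 1)) c₀ W)
        (_hPB : ∀ (y : TSite d m) (f : BondL2K ℂ d (towerP L m (n + 1)) c₀ W) (b : Bond d (towerP L m (n + 1))),
          WL2.equiv ℂ (fun _ : Bond d (towerP L m (n + 1)) => c₀) W (PB y f) b =
            if blockCoord (L ^ (n + 1)) m (siteCast (towerP_eq_fineP_pow L m (n + 1)) (bpos b)) = y then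
              WL2.equiv ℂ (fun _ : Bond d (towerP L m (n + 1)) => c₀) W f b else 0)
        (v : TSite d m) (f : BondL2K ℂ d (towerP L m (n + 1)) c₀ W)
        (_hfv : ∀ b, blockCoord (L ^ (n + 1)) m (siteCast (towerP_eq_fineP_pow L m (n + 1)) b.1) ≠ v →
          WL2.equiv ℂ (fun _ : Bond d (towerP L m (n + 1)) => c₀) W f b = 0)
        (F : ℝ) (_hF0 : 0 ≤ F) (_hfF : ∀ b, ‖WL2.equiv ℂ (fun _ : Bond d (towerP L m (n + 1)) => c₀) W f b‖ ≤ F)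
        (b₀ : Bond d (towerP L m (n + 1))),
        ‖WL2.equiv ℂ (fun _ : Bond d (towerP L m (n + 1)) => c₀) W (greenK A₀ hpos₀ f) b₀‖ ≤
          B * Real.exp (-(δ * tdist m (blockCoord (L ^ (n + 1)) m (siteCast (towerP_eq_fineP_pow L m (n + 1)) b₀.1)) v)) * F := by
  classical
  have hd1 : (1 : ℝ) ≤ d := by exact_mod_cast hd
  have hd0 : (0 : ℝ) ≤ d - 1 := by linarith
  -- the (D-E)₀,k letter, fully closed; the model letters (for `hRe`, `hIm`)
  obtain ⟨α₀f, r₁, Ablk, hα₀f, hr₁, hAblk, HDEC⟩ := exists_block_decay_localInvK_diagonal_closed hd L hL hL3 φ hMφ hMφ' hφ hφ' hstar ha ha' hϱ0 hϱ1 τ hτ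
    hCτ hτm hMτ hρw hτ₁ hτ₂ hφτ
  obtain ⟨α₀l, γ, μ₁, γ', κ₁', M', hα₀l, -, -, -, -, -, -, -, -, HL⟩ :=
    exists_H1_row_letters_diagonal_closed hd L hL hL3 φ hMφ hMφ' hφ hφ' ha ha' hϱ0 hϱ1 τ hτ hCτ hρw hτ₁ hτ₂ hφτ hMτ
  -- the fixed rates and constants
  set κ₀ : ℝ := Real.sqrt (1 / (4 * d + 1)) with hκ₀
  have hκ₀0 : 0 < κ₀ := Real.sqrt_pos.mpr (by positivity)
  set aout : ℝ := min r₁ (κ₀ / 3) with haout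
  have haout0 : 0 < aout := lt_min hr₁ (by positivity)
  have haoutr : aout ≤ r₁ := min_le_left _ _
  have haoutκ : aout ≤ κ₀ / 3 := min_le_right _ _
  set Pp : ℝ := 768 * Fintype.card (DirPair d) * Mτ * Mφ ^ 2 * ρw + 4 * (d - 1 : ℝ) * (Mφ * Mφ') with hPp
  have hPp0 : 0 ≤ Pp := by positivity
  set Θ : ℝ := 2 * Real.exp 1 * Pp * Real.exp (aout * 2) * 2 * (2 : ℝ) ^ d with hΘ
  have hΘ0 : 0 ≤ Θ := by positivity
  set αθ : ℝ := 1 / (2 * Θ + 1) with hαθ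
  have hαθ0 : 0 < αθ := by positivity
  set α₁ : ℝ := min (min α₀f α₀l) αθ with hα₁
  have hα₁0 : 0 < α₁ := lt_min (lt_min hα₀f hα₀l) hαθ0
  have hα₁f : α₁ ≤ α₀f := (min_le_left _ _).trans (min_le_left _ _)
  have hα₁l : α₁ ≤ α₀l := (min_le_left _ _).trans (min_le_right _ _)
  have hα₁θ : α₁ ≤ αθ := min_le_right _ _
  set CQ1 : ℝ := Mφ' * Mφ * Real.exp (Real.sqrt ((L : ℝ) ^ d) * (Real.sqrt (2 * d) * (102 * (d + 1) ^ 2 * L)) * (α₁ / (1 - ϱ))) with hCQ1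
  set EQ : ℝ := Real.exp (100 * d * (d + 1) * (L : ℝ) ^ d * AQ) with hEQ
  set P2 : ℝ := |a| * (Mφ' * Mφ * EQ * ((2 * d : ℕ) : ℝ) * (CQ1 * 2)) * Real.sqrt d with hP2_def
  set Kst : ℝ := (Fintype.card (Option (Fin d × Bool)) : ℝ) * Real.exp (r₁ * 1) with hKst
  set C3S : ℝ := Real.sqrt (3 ^ d * d * (2 : ℝ) ^ d) with hC3S_def
  set MSb : ℝ := Real.sqrt (2 * Real.exp 1 * latticeConst d (κ₀ / 3)) with hMSb_def
  set Abound : ℝ := 2 * Real.exp 1 * (1 + P2 * Kst * Ablk) * 2 * (2 : ℝ) ^ d + C3S * Ablk * MSb with hAbound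
  have hAbound0 : 0 ≤ Abound := by positivity
  refine ⟨α₁, 2 * Abound, aout, hα₁0, by positivity, haout0, ?_⟩
  intro n η hηL c₀ c₁ _ _ hw hρ m _ hm U αU hαU0 hα1 hU1 hreg εU hεU hUε hLb α hα hαle hUst hUb hUη hpl hεg hAQ A₀ hA₀ hpos₀ PB hPB v f hfv F hF0 hfF b₀
  have hc₀ : (0 : ℝ) < c₀ := Fact.out
  have hc₁ : (0 : ℝ) < c₁ := Fact.out
  -- `t = L^{n+1}`, the fine rate `a⋆` and its letters
  set t : ℝ := (L : ℝ) ^ (n + 1) with ht_def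
  set afine : ℝ := Real.sqrt (1 / (4 * d * t ^ 2 + 1)) with hafine
  obtain ⟨haf0, -, hlam, hκlo, hκhi⟩ : 0 < afine ∧ afine ≤ 1 ∧ 1 / 2 ≤ 1 - 2 * d * t ^ 2 * (Real.cosh afine - 1) ∧ κ₀ ≤ afine * t ∧ afine * t ≤ 1 :=
    rate_letters L n hd hL
  have hL0 : (0 : ℝ) < L := by exact_mod_cast (lt_of_lt_of_le (by norm_num) hL3 : 0 < L)
  have htpos : 0 < t := pow_pos hL0 _
  have hη : 0 < η := by
    by_contra h
    have : η * t ≤ 0 := mul_nonpos_of_nonpos_of_nonneg (not_lt.mp h) htpos.le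
    linarith only [this, hηL]
  have hηt : η⁻¹ = t := by rw [eq_inv_of_mul_eq_one_left hηL, inv_inv]
  have hlam0 : 0 < 1 - 2 * d * (η⁻¹) ^ 2 * (Real.cosh afine - 1) := by rw [hηt]; linarith only [hlam]
  have hlam' : 1 / 2 ≤ 1 - 2 * d * (η⁻¹) ^ 2 * (Real.cosh afine - 1) := by rw [hηt]; exact hlam
  have htinv : 0 < η⁻¹ := by rw [hηt]; exact htpos
  -- the block decay, symmetric orientation
  have hdec : ∀ y, ‖PB y ∘L LinearMap.toContinuousLinearMap (greenK A₀ hpos₀) ∘L PB v‖ ≤ Ablk * Real.exp (-(r₁ * tdist m y v)) := by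
    intro y
    have h := HDEC n η hηL c₀ c₁ hw hρ m hm U αU hαU0 hα1 hU1 hreg εU hεU hUε hLb α hα (hαle.trans hα₁f) hUst hUb hUη hpl hεg A₀ hA₀ hpos₀ PB hPB v y
    rwa [B4Sect5Torus.tdist_symm hm v y] at h
  -- the model letters `hRe`, `hIm` at `δ := αη²`
  obtain ⟨-, -, -, -, -, -, hRe, hIm, -⟩ := HL n η hηL c₀ c₁ hw hρ m U αU hα1 hU1 hreg εU hεU hUε hLb hα (hαle.trans hα₁l) hUst hUb hUη hpl hεg
  have hδ : 0 ≤ α * η ^ 2 := by positivity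
  -- (T) from unitarity
  have hR : ∀ (b : Bond d (towerP L m (n + 1))) (w : W), ‖adTransportW φ U b w‖ ≤ ‖w‖ :=
    fun b w => le_of_eq (norm_adTransportW_eq φ U τ hτ₂ hUst hφτ b w)
  have hS : ∀ (b : Bond d (towerP L m (n + 1))) (w : W), ‖adTransportW φ (fun b => (U b)⁻¹) b w‖ ≤ ‖w‖ :=
    fun b w => le_of_eq (norm_adTransportW_inv_eq φ U τ hτ₂ hUst hφτ b w)
  have hU' : ∀ b, ‖(U b : 𝔸)‖ ≤ 1 ∧ ‖(((U b)⁻¹ : 𝔸ˣ) : 𝔸)‖ ≤ 1 := fun b => B7Prop1Explicit.mem_U1.mp (hUb b)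
  -- the holonomy letter (K59)
  have hδK : 0 ≤ 2 * Mφ * Mφ' * (2 * (α * η ^ 2)) := by positivity
  have hHol : ∀ (x : TSite d (towerP L m (n + 1))) (μ ν : Fin d), μ ≠ ν → ∀ w : W,
      ‖adTransportW φ (fun b => (U b)⁻¹) (unshift ν x, ν) (adTransportW φ U (unshift ν x, μ) w) -
          adTransportW φ U (x, μ) (adTransportW φ (fun b => (U b)⁻¹) (shift μ (unshift ν x), ν) w)‖ ≤ 2 * Mφ * Mφ' * (2 * (α * η ^ 2)) * ‖w‖ :=
    fun x μ ν hne w => holonomy_letter U hUb hRe hIm φ hφ hφ' hMφ hMφ' hR hS x μ ν hne w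
  -- the diagonal letters
  have hc₁' : c₀ * (η⁻¹) ^ d = c₁ := by rw [hηt]; exact hw
  have hvol : ∀ ν, η⁻¹ ≤ (towerP L m (n + 1) ν : ℝ) := fun ν => by
    rw [hηt, towerP_apply, Nat.cast_mul, Nat.cast_pow]
    exact le_mul_of_one_le_right htpos.le (by exact_mod_cast hm ν)
  -- the data mass `μ = d·c₁`
  have hmass := sum_bondMass_bigBlock_le L m n hc₀.le v
  have hμeq : c₀ * (d * t ^ d) = d * c₁ := by rw [← hw]; ring
  rw [hμeq] at hmass
  have hμ : ‖f‖ ≤ Real.sqrt (d * c₁) * F := norm_le_sqrt_mass_mul v hmass f hF0 hfv hfF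
  -- the output rate
  have ha'κ₁ : aout ≤ afine * t := by linarith only [haoutκ, hκlo, hκ₀0]
  have h2a' : 2 * aout < afine * t := by linarith only [haoutκ, hκlo, hκ₀0]
  -- the contraction window: `θ ≤ 1∕2`
  have hn1 : ‖((η : ℂ)) ^ d‖ = |η| ^ d := by rw [norm_pow, Complex.norm_real, Real.norm_eq_abs]
  have hn2 : ‖((η : ℂ))⁻¹‖ ^ 2 * (α * η ^ 2) = α := by
    rw [norm_inv, Complex.norm_real, Real.norm_eq_abs, abs_of_pos hη]; field_simp
  have hpK : 768 * Fintype.card (DirPair d) * Mτ * Mφ ^ 2 * (‖((η : ℂ)) ^ d‖ / c₀) * ‖((η : ℂ))⁻¹‖ ^ 2 * (α * η ^ 2) ≤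
      768 * Fintype.card (DirPair d) * Mτ * Mφ ^ 2 * ρw * α := by
    have h0 : 0 ≤ 768 * (Fintype.card (DirPair d) : ℝ) * Mτ * Mφ ^ 2 * α := by positivity
    calc 768 * Fintype.card (DirPair d) * Mτ * Mφ ^ 2 * (‖((η : ℂ)) ^ d‖ / c₀) * ‖((η : ℂ))⁻¹‖ ^ 2 * (α * η ^ 2)
          = 768 * Fintype.card (DirPair d) * Mτ * Mφ ^ 2 * α * (|η| ^ d / c₀) := by
            rw [mul_assoc (768 * Fintype.card (DirPair d) * Mτ * Mφ ^ 2 * (‖((η : ℂ)) ^ d‖ / c₀)), hn2, hn1]; ring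
      _ ≤ 768 * Fintype.card (DirPair d) * Mτ * Mφ ^ 2 * α * ρw := mul_le_mul_of_nonneg_left hρ h0
      _ = 768 * Fintype.card (DirPair d) * Mτ * Mφ ^ 2 * ρw * α := by ring
  have hwz : ‖((η : ℂ))⁻¹ * ((η : ℂ))⁻¹‖ * ((d - 1 : ℝ) * (2 * Mφ * Mφ' * (2 * (α * η ^ 2)))) = 4 * (d - 1 : ℝ) * (Mφ * Mφ') * α := by
    rw [norm_mul, norm_inv, Complex.norm_real, Real.norm_eq_abs, abs_of_pos hη]; field_simp; ring
  have hpinf : 768 * Fintype.card (DirPair d) * Mτ * Mφ ^ 2 * (‖((η : ℂ)) ^ d‖ / c₀) * ‖((η : ℂ))⁻¹‖ ^ 2 * (α * η ^ 2) +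
      ‖((η : ℂ))⁻¹ * ((η : ℂ))⁻¹‖ * ((d - 1 : ℝ) * (2 * Mφ * Mφ' * (2 * (α * η ^ 2)))) ≤ Pp * α := by
    rw [hwz, show Pp * α = 768 * Fintype.card (DirPair d) * Mτ * Mφ ^ 2 * ρw * α + 4 * (d - 1 : ℝ) * (Mφ * Mφ') * α by rw [hPp]; ring]
    exact add_le_add hpK le_rfl
  have hpinf0 : 0 ≤ 768 * Fintype.card (DirPair d) * Mτ * Mφ ^ 2 * (‖((η : ℂ)) ^ d‖ / c₀) * ‖((η : ℂ))⁻¹‖ ^ 2 * (α * η ^ 2) +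
      ‖((η : ℂ))⁻¹ * ((η : ℂ))⁻¹‖ * ((d - 1 : ℝ) * (2 * Mφ * Mφ' * (2 * (α * η ^ 2)))) := by positivity
  have hM : Real.exp (afine * (t - 1)) * 2 ≤ 2 * Real.exp 1 := by
    have h1 : afine * (t - 1) ≤ 1 := by rw [mul_sub, mul_one]; linarith only [hκhi, haf0]
    linarith only [Real.exp_le_exp.mpr h1]
  have hSg := geom_sum_inv_le hlam' d
  have hSg0 : 0 ≤ ∑ l ∈ Finset.range d, (1 / (1 - 2 * d * (η⁻¹) ^ 2 * (Real.cosh afine - 1))) ^ l :=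
    Finset.sum_nonneg fun l _ => pow_nonneg (one_div_nonneg.mpr hlam0.le) l
  have hθhalf : Real.exp (afine * (t - 1)) * 2 *
        ((768 * Fintype.card (DirPair d) * Mτ * Mφ ^ 2 * (‖((η : ℂ)) ^ d‖ / c₀) * ‖((η : ℂ))⁻¹‖ ^ 2 * (α * η ^ 2) +
            ‖((η : ℂ))⁻¹ * ((η : ℂ))⁻¹‖ * ((d - 1 : ℝ) * (2 * Mφ * Mφ' * (2 * (α * η ^ 2))))) * Real.exp (aout * 2)) /
          (1 - 2 * d * (η⁻¹) ^ 2 * (Real.cosh afine - 1)) *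
        ∑ l ∈ Finset.range d, (1 / (1 - 2 * d * (η⁻¹) ^ 2 * (Real.cosh afine - 1))) ^ l ≤ 1 / 2 :=
    calc _ ≤ 2 * Real.exp 1 * (Pp * α) * Real.exp (aout * 2) * 2 * (2 : ℝ) ^ d := theta_le hM hlam' hSg0 hSg hpinf0 hpinf (Real.exp_nonneg _)
      _ = Θ * α := by rw [hΘ]; ring
      _ ≤ Θ * αθ := mul_le_mul_of_nonneg_left (hαle.trans hα₁θ) hΘ0
      _ ≤ 1 / 2 := by rw [hαθ, mul_one_div, div_le_iff₀ (by positivity : (0 : ℝ) < 2 * Θ + 1)]; linarith only [hΘ0]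
  have hθ := hθhalf.trans_lt (by norm_num : (1 / 2 : ℝ) < 1)
  -- (EA0S)
  have hmain := norm_localInvK_apply_le_decay L m n φ U hL αU hαU0 hα1 hU1 hreg hMφ hφ hMφ' hφ' hstar εU hεU hUε hϱ0 hϱ1 hα hεg τ hτm hMτ η hU' hδ
    hRe hIm hδK hHol hPB hm hd (le_refl d) hR hS a A₀ hA₀ hpos₀ hAblk v hdec f hfv hF0 hfF hμ hw hAQ haf0.le hlam0 htinv hc₁' hvol haout0.le haoutr
    ha'κ₁ h2a' hθ b₀
  -- `A ≤ A_bound`: the three height-dependent letters are dominated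
  have hCQ : Mφ' * Mφ * Real.exp (Real.sqrt ((L : ℝ) ^ d) * (Real.sqrt (2 * d) * (102 * (d + 1) ^ 2 * L)) * (α / (1 - ϱ))) ≤ CQ1 := by
    rw [hCQ1]
    refine mul_le_mul_of_nonneg_left (Real.exp_le_exp.mpr (mul_le_mul_of_nonneg_left ?_ (by positivity))) (mul_nonneg hMφ' hMφ)
    exact div_le_div_of_nonneg_right hαle (by linarith only [hϱ1])
  have hP2 : |a| * (Mφ' * Mφ * Real.exp (100 * d * (d + 1) * (L : ℝ) ^ d * AQ) * ((2 * d : ℕ) : ℝ) *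
      ((Mφ' * Mφ * Real.exp (Real.sqrt ((L : ℝ) ^ d) * (Real.sqrt (2 * d) * (102 * (d + 1) ^ 2 * L)) * (α / (1 - ϱ)))) / Real.sqrt c₁ * 2)) *
      Real.sqrt (d * c₁) ≤ P2 := by
    rw [Real.sqrt_mul' _ hc₁.le]
    exact p2_bound (abs_nonneg a) (by positivity) (Real.sqrt_pos.mpr hc₁).ne' (Real.sqrt_nonneg _) hCQ
  have hC3S : Real.sqrt (3 ^ d / c₁ * ((1 - 2 * d * (η⁻¹) ^ 2 * (Real.cosh afine - 1)) ^ d)⁻¹) * Real.sqrt (d * c₁) ≤ C3S := by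
    rw [← Real.sqrt_mul' _ (by positivity : (0 : ℝ) ≤ d * c₁), hC3S_def]
    refine Real.sqrt_le_sqrt ?_
    have hl2 : ((1 - 2 * d * (η⁻¹) ^ 2 * (Real.cosh afine - 1)) ^ d)⁻¹ ≤ (2 : ℝ) ^ d := by
      rw [← inv_pow]
      exact pow_le_pow_left₀ (inv_nonneg.mpr hlam0.le) (by rw [inv_le_comm₀ hlam0 (by norm_num)]; linarith only [hlam']) d
    calc 3 ^ d / c₁ * ((1 - 2 * d * (η⁻¹) ^ 2 * (Real.cosh afine - 1)) ^ d)⁻¹ * (d * c₁)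
        = 3 ^ d * d * ((1 - 2 * d * (η⁻¹) ^ 2 * (Real.cosh afine - 1)) ^ d)⁻¹ * (c₁ / c₁) := by ring
      _ = 3 ^ d * d * ((1 - 2 * d * (η⁻¹) ^ 2 * (Real.cosh afine - 1)) ^ d)⁻¹ := by rw [div_self hc₁.ne', mul_one]
      _ ≤ 3 ^ d * d * (2 : ℝ) ^ d := mul_le_mul_of_nonneg_left hl2 (by positivity)
  have hMSb : Real.sqrt (Real.exp (afine * (t - 1)) * 2 * latticeConst d (afine * t - 2 * aout)) ≤ MSb := by
    rw [hMSb_def]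
    refine Real.sqrt_le_sqrt ?_
    have hK : latticeConst d (afine * t - 2 * aout) ≤ latticeConst d (κ₀ / 3) :=
      latticeConst_antitone (div_pos hκ₀0 (by norm_num)) (by linarith only [haoutκ, hκlo])
    have hK0 : 0 ≤ latticeConst d (afine * t - 2 * aout) := latticeConst_nonneg d (by linarith only [h2a', haout0])
    calc Real.exp (afine * (t - 1)) * 2 * latticeConst d (afine * t - 2 * aout) ≤ (2 * Real.exp 1) * latticeConst d (afine * t - 2 * aout) :=
          mul_le_mul_of_nonneg_right hM hK0
      _ ≤ 2 * Real.exp 1 * latticeConst d (κ₀ / 3) := mul_le_mul_of_nonneg_left hK (by positivity)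
  have hA := assemble_le (K := Kst) (CE := Ablk) hM hlam' hSg0 hSg (by positivity) (by positivity) hAblk (Real.sqrt_nonneg _) (Real.sqrt_nonneg _)
    (Real.sqrt_nonneg _) hP2 hC3S hMSb d
  exact hmain.trans (mul_le_mul_of_nonneg_right (mul_le_mul_of_nonneg_right (closing_le hA hθhalf hAbound0) (Real.exp_nonneg _)) hF0)

end Closed

end Literature.MathematicalPhysics.QuantumFieldTheory.Balaban1983to89.B9Eq326LocalPartTowerSupDecayDiagonalClosed

end
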